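import Summits.CriticalPhenomena.PercolationContinuityZ3.Theorems.PercShatteringRaceDefs
import Summits.CriticalPhenomena.PercolationContinuityZ3.Theorems.PercShatteringRaceNearLinearTwoClusterDecayStubShellIndependence
import Summits.CriticalPhenomena.PercolationContinuityZ3.Theorems.PercShatteringRaceNearLinearTwoClusterDecayStubKissMerge
import Summits.CriticalPhenomena.PercolationContinuityZ3.Theorems.PercShatteringRaceNearLinearTwoClusterDecayStubDoorTransfer
import Summits.CriticalPhenomena.PercolationContinuityZ3.Theorems.PercShatteringRaceNearLinearTwoClusterDecayStubDoorCauchySchwarz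
import Literature.Probability.Percolation.CriticalContinuityProofs
import Literature.Probability.Percolation.SharpnessDCTProofs

/-!
# Crux `PercShatteringRace.NearLinearTwoClusterDecay` (stmt-CriticalPhenomena-5785), line `shell-product-kiss-positivity` —
# the kiss surgery from the door engine (certified glue)

Helper file of the crux skeleton `Cruxes/NearLinearTwoClusterDecay/Lines/shell_product_kiss_positivity.lean` (seat c1),
over the route vocabulary `Theorems/PercShatteringRaceDefs.lean` (namespace `NearLinearTwoClusterDecayKiss`).
It instantiates the three LANDED generic stubs of the line — `stub_kissMerge` (opening a kiss edge lowers the crossing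
number by exactly one), `stub_doorTransfer` (single-edge flux inequality `p · P(L k ∩ {D ≠ ∅}) ≤ ∫_{L(k-1)} F`) and
`stub_doorCauchySchwarz` (`(∫_A F)² ≤ P(A ∩ {F ≠ 0}) ∫_A F²`) — at `E = shellPairs r R`, `L = Level r R`,
`D = kissEdges r R`, `F = fibre r R k`, proving the side conditions (determinedness of the counting events by the shell
pairs, kiss edges are closed lattice bonds of the shell, congruence and bounds of the fibre weight), and derives the
KISS SURGERY inequality of the line in the bounded-fibre regime:

`kissSurgery_of_boundedFibre : 2 ≤ k → BoundedFibreAt M k → ∃ c > 0, ∀ large r,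
   c · P(N(r,Mr) = k, Kiss) ≤ 1 - P(N(r,Mr) ≥ k)`  with `c = p_c / C`.

Chain: `p_c P(N = k, Kiss) ≤ p_c P(Level k ∩ {kissEdges ≠ ∅}) ≤ ∫_{N = k-1} F_k` (door transfer)
`≤ C · P(N = k-1, F_k ≠ 0)` (Cauchy–Schwarz + bounded fibre) `≤ C (1 - P(N ≥ k))` (disjointness, measurability).
Lands with `--supports stmt-CriticalPhenomena-5785` (registered bridge `kissSurgery_of_boundedFibre`).
-/

noncomputable section

namespace Summit.CriticalPhenomena.PercolationContinuityZ3.Theorems.NearLinearTwoClusterDecayKiss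

open MeasureTheory Filter
open Literature.Probability.LatticeModels Literature.Probability.Percolation

/-! ### Instantiation glue for the door engine -/

/-- The closed shell as a set is the coercion of the closed shell as a `Finset`. -/
theorem coe_shellF (r R : ℕ) : (↑(shellF r R) : Set (Site 3)) = shell r R := by
  simp only [shellF, shell, Finset.coe_sdiff]

/-- The pairs of the shell contain `(shell r R).sym2`. -/
theorem shell_sym2_subset (r R : ℕ) : (shell r R).sym2 ⊆ (↑(shellPairs r R) : Set (Sym2 (Site 3))) := by
  rw [shellPairs, Finset.coe_sym2, coe_shellF]

/-- Configurations agreeing on the shell pairs lie in the same shell connection events. -/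
theorem openConnIn_congr {r R : ℕ} {ω ω' : BondConfig (Site 3)}
    (h : ω ∩ ↑(shellPairs r R) = ω' ∩ ↑(shellPairs r R)) (x y : Site 3) :
    ω ∈ openConnIn (shell r R) x y ↔ ω' ∈ openConnIn (shell r R) x y :=
  NearLinearTwoClusterDecayShellIndep.mem_openConnIn_congr (shell_sym2_subset r R) h x y

/-- `{N ≥ k}` is determined by the shell pairs. -/
theorem determinedBy_atLeast (r R k : ℕ) :
    DeterminedBy (AtLeast r R k) (↑(shellPairs r R) : Set (Sym2 (Site 3))) := by
  rw [determinedBy_iff]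
  intro ω ω' h
  simp only [AtLeast, crossPts, Set.mem_setOf_eq, openConnIn_congr h]

/-- `{N = k}` is determined by the shell pairs. -/
theorem determinedBy_level (r R k : ℕ) :
    DeterminedBy (Level r R k) (↑(shellPairs r R) : Set (Sym2 (Site 3))) := by
  rw [determinedBy_iff]
  intro ω ω' h
  simp only [Level, Set.mem_sdiff, (determinedBy_iff _ _).1 (determinedBy_atLeast r R k) ω ω' h,
    (determinedBy_iff _ _).1 (determinedBy_atLeast r R (k + 1)) ω ω' h]

/-- `{N ≥ k}` is measurable. -/
theorem measurableSet_atLeast (r R k : ℕ) : MeasurableSet (AtLeast r R k) :=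
  (determinedBy_atLeast r R k).measurableSet_of_finset

/-- The kiss edges are congruent under agreement on the shell pairs. -/
theorem kissEdges_congr {r R : ℕ} {ω ω' : BondConfig (Site 3)}
    (h : ω ∩ ↑(shellPairs r R) = ω' ∩ ↑(shellPairs r R)) : kissEdges r R ω = kissEdges r R ω' := by
  classical
  unfold kissEdges
  refine Finset.filter_congr fun e _ => ?_
  simp only [crossBody, Set.mem_setOf_eq, openConnIn_congr h]

/-- Endpoints of shell connection events lie in the shell. -/
theorem mem_shell_of_openConnIn {r R : ℕ} {ω : BondConfig (Site 3)} {x y : Site 3}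
    (h : ω ∈ openConnIn (shell r R) x y) : x ∈ shell r R ∧ y ∈ shell r R := by
  obtain ⟨hx, hy, -⟩ := h
  exact ⟨hx, hy⟩

/-- An open lattice edge of the shell joins its endpoints inside the shell. -/
theorem openConnIn_of_mem {r R : ℕ} {ω : BondConfig (Site 3)} {u v : Site 3} (huv : (zdGraph 3).Adj u v)
    (hu : u ∈ shell r R) (hv : v ∈ shell r R) (he : s(u, v) ∈ ω) : ω ∈ openConnIn (shell r R) u v :=
  DCT16.mem_openConnIn_iff_pathIn.2 (PathIn.of_adj hu hv ((openGraph_adj ω u v).2 ⟨he, huv.ne⟩))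

/-- Kiss edges are lattice edges among the shell pairs, and they are CLOSED. -/
theorem kissEdges_spec (r R : ℕ) (ω : BondConfig (Site 3)) :
    ∀ e ∈ kissEdges r R ω, e ∈ shellPairs r R ∧ e ∈ (zdGraph 3).edgeSet ∧ e ∉ ω := by
  classical
  intro e he
  unfold kissEdges at he
  rw [Finset.mem_filter] at he
  obtain ⟨heP, heE, u, v, rfl, hu, hv, huv⟩ := he
  refine ⟨heP, heE, fun heω => huv ?_⟩
  obtain ⟨x, -, y, -, hxu, huy⟩ := hu
  obtain ⟨x', -, y', -, hxv, hvy⟩ := hv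
  exact openConnIn_of_mem ((SimpleGraph.mem_edgeSet _).1 heE) (mem_shell_of_openConnIn hxu).2
    (mem_shell_of_openConnIn hxv).2 heω

/-- A kiss produces a kiss edge. -/
theorem kissEdges_nonempty_of_kiss {r R : ℕ} {ω : BondConfig (Site 3)} (h : ω ∈ Kiss r R) :
    (kissEdges r R ω).Nonempty := by
  classical
  obtain ⟨u, v, hadj, hu, hv, huv⟩ := h
  refine ⟨s(u, v), ?_⟩
  unfold kissEdges
  rw [Finset.mem_filter]
  refine ⟨?_, (SimpleGraph.mem_edgeSet _).2 hadj, u, v, rfl, hu, hv, huv⟩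
  obtain ⟨x, -, y, -, hxu, -⟩ := hu
  obtain ⟨x', -, y', -, hxv, -⟩ := hv
  have hu' : u ∈ shellF r R := by
    rw [← Finset.mem_coe, coe_shellF]; exact (mem_shell_of_openConnIn hxu).2
  have hv' : v ∈ shellF r R := by
    rw [← Finset.mem_coe, coe_shellF]; exact (mem_shell_of_openConnIn hxv).2
  exact Finset.mk_mem_sym2_iff.2 ⟨hu', hv'⟩

/-- The merge property of the kiss edges (instance of `stub_kissMerge` with `S = shell r R`, `A = sphere r`,
`B = sphere R`): opening a kiss edge of a level-`(k+1)` configuration gives a level-`k` configuration. -/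
theorem insert_mem_level {r R k : ℕ} {ω : BondConfig (Site 3)} (hω : ω ∈ Level r R (k + 1))
    {e : Sym2 (Site 3)} (he : e ∈ kissEdges r R ω) : insert e ω ∈ Level r R k := by
  classical
  unfold kissEdges at he
  rw [Finset.mem_filter] at he
  obtain ⟨-, heE, u, v, rfl, hu, hv, huv⟩ := he
  obtain ⟨x, hx, y, hy, hxu, huy⟩ := hu
  obtain ⟨x', hx', y', hy', hxv, hvy⟩ := hv
  have h := stub_kissMerge (shell r R) (↑(innerBoundary (zdGraph 3) (box 3 r)) : Set (Site 3)) (↑(innerBoundary (zdGraph 3) (box 3 R)) : Set (Site 3)) k ω u v ((SimpleGraph.mem_edgeSet _).1 heE)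
    ⟨x, hx, y, hy, hxu, huy⟩ ⟨x', hx', y', hy', hxv, hvy⟩ huv ⟨hω.1, hω.2⟩
  exact ⟨h.1, h.2⟩

/-- The merge property in the form consumed by the door transfer (`k ≥ 1`). -/
theorem insert_mem_level_pred {r R k : ℕ} (hk : 1 ≤ k) {ω : BondConfig (Site 3)} (hω : ω ∈ Level r R k)
    {e : Sym2 (Site 3)} (he : e ∈ kissEdges r R ω) : insert e ω ∈ Level r R (k - 1) := by
  obtain ⟨j, rfl⟩ : ∃ j, k = j + 1 := ⟨k - 1, by omega⟩
  rw [Nat.add_sub_cancel]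
  exact insert_mem_level hω he

/-- The fibre weight is congruent under agreement on the shell pairs. -/
theorem fibre_congr {r R k : ℕ} {ω ω' : BondConfig (Site 3)}
    (h : ω ∩ ↑(shellPairs r R) = ω' ∩ ↑(shellPairs r R)) : fibre r R k ω = fibre r R k ω' := by
  unfold fibre
  refine Finset.sum_congr rfl fun b hb => ?_
  have hbω : b ∈ ω ↔ b ∈ ω' := by
    have := congrArg (fun T : Set (Sym2 (Site 3)) => b ∈ T) h
    simpa [hb] using this
  have hagree : (ω \ {b}) ∩ ↑(shellPairs r R) = (ω' \ {b}) ∩ ↑(shellPairs r R) := by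
    rw [Set.sdiff_eq, Set.sdiff_eq, Set.inter_right_comm, h, Set.inter_right_comm]
  have hL : ω \ {b} ∈ Level r R k ↔ ω' \ {b} ∈ Level r R k :=
    (determinedBy_iff _ _).1 (determinedBy_level r R k) _ _ hagree
  have hK : kissEdges r R (ω \ {b}) = kissEdges r R (ω' \ {b}) := kissEdges_congr hagree
  by_cases hmem : ω ∈ {ω' : BondConfig (Site 3) | b ∈ ω' ∧ ω' \ {b} ∈ Level r R k ∧
      b ∈ kissEdges r R (ω' \ {b})}
  · have hmem' : ω' ∈ {ω' : BondConfig (Site 3) | b ∈ ω' ∧ ω' \ {b} ∈ Level r R k ∧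
        b ∈ kissEdges r R (ω' \ {b})} := by
      simp only [Set.mem_setOf_eq] at hmem ⊢
      exact ⟨hbω.1 hmem.1, hL.1 hmem.2.1, hK ▸ hmem.2.2⟩
    rw [Set.indicator_of_mem hmem, Set.indicator_of_mem hmem', hK]
  · have hmem' : ω' ∉ {ω' : BondConfig (Site 3) | b ∈ ω' ∧ ω' \ {b} ∈ Level r R k ∧
        b ∈ kissEdges r R (ω' \ {b})} := by
      simp only [Set.mem_setOf_eq] at hmem ⊢
      exact fun h' => hmem ⟨hbω.2 h'.1, hL.2 h'.2.1, hK.symm ▸ h'.2.2⟩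
    rw [Set.indicator_of_notMem hmem, Set.indicator_of_notMem hmem']

/-- The fibre weight is non-negative. -/
theorem fibre_nonneg (r R k : ℕ) (ω : BondConfig (Site 3)) : 0 ≤ fibre r R k ω := by
  unfold fibre
  refine Finset.sum_nonneg fun b _ => Set.indicator_nonneg (fun _ _ => ?_) _
  positivity

/-- The fibre weight is at most the number of shell pairs. -/
theorem fibre_le (r R k : ℕ) (ω : BondConfig (Site 3)) : fibre r R k ω ≤ (shellPairs r R).card := by
  unfold fibre
  have h : ∀ b ∈ shellPairs r R,
      Set.indicator {ω' : BondConfig (Site 3) | b ∈ ω' ∧ ω' \ {b} ∈ Level r R k ∧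
        b ∈ kissEdges r R (ω' \ {b})} (fun ω' => (1 : ℝ) / ((kissEdges r R (ω' \ {b})).card : ℝ)) ω ≤ 1 := by
    intro b _
    refine Set.indicator_apply_le' (fun _ => ?_) (fun _ => zero_le_one)
    by_cases h0 : (kissEdges r R (ω \ {b})).card = 0
    · rw [h0]; simp
    · have hpos : 0 < (kissEdges r R (ω \ {b})).card := Nat.pos_of_ne_zero h0
      rw [div_le_one (by exact_mod_cast hpos)]
      exact_mod_cast hpos
  calc _ ≤ ∑ b ∈ shellPairs r R, (1 : ℝ) := Finset.sum_le_sum h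
    _ = (shellPairs r R).card := by simp

/-! ### The kiss surgery from the door engine -/

/-- **Kiss surgery in the bounded-fibre regime** (the planner's `stub_kissSurgery`, now a theorem of the landed
generic stubs and the open shape atom `BoundedFibreAt M k`): for `2 ≤ k` there is `c > 0` with `c · P(N(r,Mr) = k, Kiss) ≤ 1 - P(N(r,Mr) ≥ k)` for all large `r`, with
`c = p_c / C` (`C` from `BoundedFibreAt M k`).  Chain: `p_c P(N=k, Kiss) ≤ p_c P(L k ∩ {D ≠ ∅}) ≤ ∫_{N=k-1} F`
(door transfer) `≤ C · P(N = k-1, F ≠ 0)` (Cauchy–Schwarz + bounded fibre) `≤ C (1 - P(N ≥ k))`. -/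
theorem kissSurgery_of_boundedFibre {M k : ℕ} (hk : 2 ≤ k) (hBF : BoundedFibreAt M k) :
    ∃ c : ℝ, 0 < c ∧ ∃ r₁ : ℕ, ∀ r : ℕ, r₁ ≤ r →
      c * (bondPercolation (zdGraph 3) (criticalProbI 3)).real (Level r (M * r) k ∩ Kiss r (M * r)) ≤
        1 - (bondPercolation (zdGraph 3) (criticalProbI 3)).real (AtLeast r (M * r) k) := by
  obtain ⟨C, hC, r₁, hBF⟩ := hBF
  have pc_pos : 0 < ((criticalProbI 3 : unitInterval) : ℝ) := by
    rw [coe_criticalProbI]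
    exact (Grimmett1999_criticalProb_pos_lt_one_holds 3 (by norm_num)).1
  refine ⟨(criticalProbI 3 : ℝ) / C, div_pos pc_pos hC, r₁, fun r hr => ?_⟩
  set R := M * r with hR
  -- the door transfer, instantiated
  have hDT := stub_doorTransfer (criticalProbI 3) (shellPairs r R) (Level r R) (kissEdges r R) k
    (determinedBy_level r R) (fun ω ω' h => kissEdges_congr h) (kissEdges_spec r R)
    (fun ω hω e he => insert_mem_level_pred (by omega) hω he)
  change (criticalProbI 3 : ℝ) * (bondPercolation (zdGraph 3) (criticalProbI 3)).real (Level r R k ∩ {ω | (kissEdges r R ω).Nonempty}) ≤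
    ∫ ω in Level r R (k - 1), fibre r R k ω ∂(bondPercolation (zdGraph 3) (criticalProbI 3)) at hDT
  -- Cauchy–Schwarz, instantiated
  have hCS := stub_doorCauchySchwarz (criticalProbI 3) (shellPairs r R) (Level r R (k - 1)) (fibre r R k)
    ((shellPairs r R).card) (determinedBy_level r R (k - 1)) (fun ω ω' h => fibre_congr h)
    (fibre_nonneg r R k) (fibre_le r R k)
  change (∫ ω in Level r R (k - 1), fibre r R k ω ∂(bondPercolation (zdGraph 3) (criticalProbI 3))) ^ 2 ≤
    (bondPercolation (zdGraph 3) (criticalProbI 3)).real (Level r R (k - 1) ∩ {ω | fibre r R k ω ≠ 0}) * ∫ ω in Level r R (k - 1), fibre r R k ω ^ 2 ∂(bondPercolation (zdGraph 3) (criticalProbI 3))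
    at hCS
  have hBF' := hBF r hr
  set I := ∫ ω in Level r R (k - 1), fibre r R k ω ∂(bondPercolation (zdGraph 3) (criticalProbI 3)) with hI
  set J := ∫ ω in Level r R (k - 1), fibre r R k ω ^ 2 ∂(bondPercolation (zdGraph 3) (criticalProbI 3)) with hJ
  set q := (bondPercolation (zdGraph 3) (criticalProbI 3)).real (Level r R (k - 1) ∩ {ω | fibre r R k ω ≠ 0}) with hq
  set P := (bondPercolation (zdGraph 3) (criticalProbI 3)).real (AtLeast r R k) with hP
  have hI0 : 0 ≤ I :=
    setIntegral_nonneg (determinedBy_level r R (k - 1)).measurableSet_of_finset fun ω _ => fibre_nonneg r R k ω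
  have hq0 : 0 ≤ q := measureReal_nonneg
  have hP1 : P ≤ 1 := measureReal_le_one
  -- `P(N = k-1, F ≠ 0) ≤ P(N = k-1) ≤ 1 - P(N ≥ k)` (disjointness + measurability of `{N ≥ k}`)
  have hq1 : q ≤ 1 - P := by
    have h1 : q ≤ (bondPercolation (zdGraph 3) (criticalProbI 3)).real (Level r R (k - 1)) := measureReal_mono Set.inter_subset_left
    have hk1 : k - 1 + 1 = k := by omega
    have hdisj : Disjoint (Level r R (k - 1)) (AtLeast r R k) := by
      rw [Set.disjoint_left]
      rintro ω ⟨-, hω⟩ hω'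
      rw [hk1] at hω
      exact hω hω'
    have h2 : (bondPercolation (zdGraph 3) (criticalProbI 3)).real (Level r R (k - 1)) + P ≤ 1 := by
      rw [hP, ← measureReal_union hdisj (measurableSet_atLeast r R k)]
      exact measureReal_le_one
    linarith
  -- `∫ F ≤ C (1 - P(N ≥ k))`
  have hIle : I ≤ C * (1 - P) := by
    by_cases hIpos : 0 < I
    · have h1 : I * I ≤ (q * C) * I := by
        have : q * J ≤ q * (C * I) := mul_le_mul_of_nonneg_left hBF' hq0
        nlinarith [hCS, this]
      have h2 : I ≤ q * C := le_of_mul_le_mul_right h1 hIpos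
      calc I ≤ q * C := h2
        _ ≤ (1 - P) * C := by gcongr
        _ = C * (1 - P) := by ring
    · have hI0' : I = 0 := le_antisymm (not_lt.1 hIpos) hI0
      rw [hI0']
      exact mul_nonneg hC.le (by linarith)
  -- `P(N = k, Kiss) ≤ P(L k ∩ {D ≠ ∅})`
  have hmono : (bondPercolation (zdGraph 3) (criticalProbI 3)).real (Level r R k ∩ Kiss r R) ≤ (bondPercolation (zdGraph 3) (criticalProbI 3)).real (Level r R k ∩ {ω | (kissEdges r R ω).Nonempty}) :=
    measureReal_mono (Set.inter_subset_inter_right _ fun ω hω => kissEdges_nonempty_of_kiss hω)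
  have hC1 : 0 ≤ 1 / C := by positivity
  calc (criticalProbI 3 : ℝ) / C * (bondPercolation (zdGraph 3) (criticalProbI 3)).real (Level r R k ∩ Kiss r R)
      = (1 / C) * ((criticalProbI 3 : ℝ) * (bondPercolation (zdGraph 3) (criticalProbI 3)).real (Level r R k ∩ Kiss r R)) := by ring
    _ ≤ (1 / C) * ((criticalProbI 3 : ℝ) * (bondPercolation (zdGraph 3) (criticalProbI 3)).real (Level r R k ∩ {ω | (kissEdges r R ω).Nonempty})) :=
        mul_le_mul_of_nonneg_left (mul_le_mul_of_nonneg_left hmono pc_pos.le) hC1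
    _ ≤ (1 / C) * I := mul_le_mul_of_nonneg_left hDT hC1
    _ ≤ (1 / C) * (C * (1 - P)) := mul_le_mul_of_nonneg_left hIle hC1
    _ = 1 - P := by field_simp

end Summit.CriticalPhenomena.PercolationContinuityZ3.Theorems.NearLinearTwoClusterDecayKiss

end
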